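import Mathlib
import Summits.NavierStokesRegularity.NavierStokesRegularity.Theorems.TaoLadderRungTwoBreakBlowupRigidityOneNilpotentTables
import Summits.NavierStokesRegularity.NavierStokesRegularity.Theorems.TaoLadderRungTwoBreakBlowupRigidityOneSquareFreeOneMode
import HarnessLib

/-!
# The SELF-SUSTAINING CORE normal form: a table is either NILPOTENT (settled on all sides of K2(1)
  `TaoLadderRungTwoBreak.BlowupRigidityOne`, stmt-NavierStokesRegularity-20206, by `…NilpotentTables`) or it contains
  a non-empty set `C` of modes each of which is driven by a monomial with BOTH inputs in `C`; hence a robust blow-up, a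
  surviving admissible eternal solution, or a non-trivial admissible DSS wave each FORCE such a core (`--supports`)

MODEL lattice ODEs only (Tao 2016 §4 (4.1)–(4.3), Thm. 4.2 statement shape, §6.4); nothing here is a statement about the
Navier–Stokes equations; NO item is closed.  DEF-FREE (core = the displayed property of a `Finset`); ROUTE-INDEPENDENT.
Pure combinatorics of the structure constants plus the three vanishing theorems of `…NilpotentTables`.

* `nilpotent_of_no_core` — PEELING: if every non-empty set of modes contains a mode with no driver from inside the set
  (no `α_{jk i,μ} ≠ 0`, `μ ∈ S`, with `j, k` in the set), then the table admits a nilpotent ranking (induction on the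
  set: rank the undriven mode lowest);
* `nilpotent_or_core` — DICHOTOMY: every table is nilpotent or has a self-sustaining core;
* `core_of_noGlobalCascade`, `core_of_eternalSurviving`, `core_of_dssWave_nontrivial` — NUMBERS for the census: on any
  table (any spread, any `ε₀ > 0` resp. any `ε₀`), the hypothesis of K2(1) / of `stub_eternalIsDSS` and the conclusion
  of K2(1) each force a SELF-SUSTAINING CORE of modes (dyadic member: `C = {0}`, `x₀² ↦ x₀`; twin rotor: `C = {0,1}`);
  below the dyadic spread the core has `≥ 2` modes (`two_le_card_core_of_lt_two`: a one-mode core needs a square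
  coefficient).

HONEST LABEL: bookkeeping normal form for the planner (where any proof or refutation of K2(1) / the rung leaf must work);
no stub, crux, rung or summit is proved; rung 0.
-/

noncomputable section

-- the summit and its single sub-problem share the name (CONVENTIONS §1)
set_option linter.dupNamespace false

open Set Filter Topology MeasureTheory

namespace Summit.NavierStokesRegularity.NavierStokesRegularity.Theorems

namespace BlowupRigidityOne

open Literature.Analysis.FluidPDE Literature.Analysis.FluidPDE.TaoCascade
  Literature.Analysis.FluidPDE.Tao2016AveragedNS

variable {m : ℕ} {R ε₀ : ℝ} {α : Fin m → Fin m → Fin m → ℤ × ℤ × ℤ → ℝ}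

/-! ## Peeling: no self-sustaining core ⇒ nilpotent -/

/-- **PEELING.**  If every non-empty set `C` of modes contains a mode `i ∈ C` with NO driver from inside `C` (no
`μ ∈ S`, `j, k ∈ C` with `α_{jk i,μ} ≠ 0`), then for every set `S` of modes there is a ranking `rank : Fin m → ℕ` such that
every driver of a mode `i ∈ S` with both inputs in `S` has an input of rank below `rank i` (induction on `S`: put the
undriven mode of `S` at the bottom and lift the ranking of the rest by one).
[cite: Tao2016AveragedNS, §4 (4.1); cell vocabulary (nilpotent ranking, self-sustaining core)] -/
theorem nilpotentOn_of_no_core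
    (hno : ∀ C : Finset (Fin m), C.Nonempty → ∃ i ∈ C, ∀ μ ∈ shiftSet, ∀ j ∈ C, ∀ k ∈ C, α j k i μ = 0)
    (S : Finset (Fin m)) :
    ∃ rank : Fin m → ℕ, ∀ μ ∈ shiftSet, ∀ i ∈ S, ∀ j ∈ S, ∀ k ∈ S,
      α j k i μ ≠ 0 → rank j < rank i ∨ rank k < rank i := by
  classical
  induction S using Finset.strongInduction with
  | H S ih =>
    by_cases hS : S.Nonempty
    · obtain ⟨i₀, hi₀, hfree⟩ := hno S hS
      obtain ⟨r, hr⟩ := ih (S.erase i₀) (Finset.erase_ssubset hi₀)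
      refine ⟨fun i => if i = i₀ then 0 else r i + 1, fun μ hμ i hi j hj k hk hne => ?_⟩
      dsimp only
      by_cases hii : i = i₀
      · subst hii
        exact absurd (hfree μ hμ j hj k hk) hne
      · have hi' : i ∈ S.erase i₀ := Finset.mem_erase.2 ⟨hii, hi⟩
        by_cases hji : j = i₀
        · left; rw [if_pos hji, if_neg hii]; exact Nat.succ_pos _
        · by_cases hki : k = i₀
          · right; rw [if_pos hki, if_neg hii]; exact Nat.succ_pos _
          · have hj' : j ∈ S.erase i₀ := Finset.mem_erase.2 ⟨hji, hj⟩
            have hk' : k ∈ S.erase i₀ := Finset.mem_erase.2 ⟨hki, hk⟩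
            rcases hr μ hμ i hi' j hj' k hk' hne with h | h
            · left; rw [if_neg hji, if_neg hii]; omega
            · right; rw [if_neg hki, if_neg hii]; omega
    · refine ⟨fun _ => 0, fun μ _ i hi => ?_⟩
      exact absurd ⟨i, hi⟩ hS

/-- **DICHOTOMY: nilpotent or a self-sustaining core.**  Every table either admits a nilpotent ranking (every non-zero
`α_{jk i,μ}`, `μ ∈ S`, has an input of rank below its output) or contains a non-empty set `C` of modes each driven by a
monomial with both inputs in `C`.
[cite: Tao2016AveragedNS, §4 (4.1); cell vocabulary (nilpotent ranking, self-sustaining core)] -/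
theorem nilpotent_or_core (α : Fin m → Fin m → Fin m → ℤ × ℤ × ℤ → ℝ) :
    (∃ rank : Fin m → ℕ, ∀ μ ∈ shiftSet, ∀ j k i, α j k i μ ≠ 0 → rank j < rank i ∨ rank k < rank i) ∨
    (∃ C : Finset (Fin m), C.Nonempty ∧ ∀ i ∈ C, ∃ μ ∈ shiftSet, ∃ j ∈ C, ∃ k ∈ C, α j k i μ ≠ 0) := by
  classical
  by_cases hcore : ∃ C : Finset (Fin m), C.Nonempty ∧ ∀ i ∈ C, ∃ μ ∈ shiftSet, ∃ j ∈ C, ∃ k ∈ C, α j k i μ ≠ 0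
  · exact Or.inr hcore
  · left
    push Not at hcore
    obtain ⟨rank, hr⟩ := nilpotentOn_of_no_core (α := α) (fun C hC => hcore C hC) Finset.univ
    exact ⟨rank, fun μ hμ j k i hne => hr μ hμ i (Finset.mem_univ i) j (Finset.mem_univ j) k (Finset.mem_univ k) hne⟩

/-! ## Consequences: the three object classes of K2(1) force a core -/

/-- **A robust blow-up forces a self-sustaining core.**  If `α ∈ E₂(R)` and `NoGlobalCascade ε₀ α X₀` (`ε₀ > 0`), then
some non-empty set `C` of modes has every member driven from `C × C` (else the table is nilpotent and never blows up
robustly, `not_noGlobalCascade_of_nilpotent`).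
[cite: Tao2016AveragedNS, §4 Thm. 4.2 (statement shape); cell vocabulary (`NoGlobalCascade`, self-sustaining core)] -/
theorem core_of_noGlobalCascade (hε : 0 < ε₀) (hα : InTableClass R α) {X₀ : Fin m → ℝ}
    (hNG : NoGlobalCascade ε₀ α X₀) :
    ∃ C : Finset (Fin m), C.Nonempty ∧ ∀ i ∈ C, ∃ μ ∈ shiftSet, ∃ j ∈ C, ∃ k ∈ C, α j k i μ ≠ 0 := by
  rcases nilpotent_or_core α with ⟨rank, hnil⟩ | hcore
  · exact absurd hNG (not_noGlobalCascade_of_nilpotent hε hα rank hnil X₀)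
  · exact hcore

/-- **A surviving admissible eternal solution forces a self-sustaining core** (any table, any `ε₀`, any exponent `a`).
[cite: Tao2016AveragedNS, §4 (4.8), §6.4; cell vocabulary (`IsEternal`, `EternalSurvivingFwd`, self-sustaining core)] -/
theorem core_of_eternalSurviving {W : ℤ → ℝ → Em m} {a : ℝ} (hW : IsEternal ε₀ α W)
    (hS : EternalSurvivingFwd a ε₀ W) :
    ∃ C : Finset (Fin m), C.Nonempty ∧ ∀ i ∈ C, ∃ μ ∈ shiftSet, ∃ j ∈ C, ∃ k ∈ C, α j k i μ ≠ 0 := by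
  rcases nilpotent_or_core α with ⟨rank, hnil⟩ | hcore
  · exact absurd hS (not_eternalSurvivingFwd_of_nilpotent rank hnil hW a)
  · exact hcore

/-- **A non-trivial admissible DSS wave forces a self-sustaining core** (any table, any `ε₀`, delay, profile family).
[cite: Tao2016AveragedNS, §4 Lemma 4.1 (iii) (4.8); cell vocabulary (`IsDSSWave`, self-sustaining core)] -/
theorem core_of_dssWave_nontrivial {ρ : Type*} [Fintype ρ] {π : Equiv.Perm ρ} {T : ℝ} {Φ : ρ → ℝ → Em m}
    (hW : IsDSSWave ε₀ α π T Φ) (hne : ∃ r x, Φ r x ≠ 0) :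
    ∃ C : Finset (Fin m), C.Nonempty ∧ ∀ i ∈ C, ∃ μ ∈ shiftSet, ∃ j ∈ C, ∃ k ∈ C, α j k i μ ≠ 0 := by
  rcases nilpotent_or_core α with ⟨rank, hnil⟩ | hcore
  · obtain ⟨r, x, h⟩ := hne
    exact absurd (dssWave_trivial_of_nilpotent rank hnil hW r x) h
  · exact hcore

/-- **Below the dyadic spread a core has at least two modes.**  On `α ∈ E₂(R)`, `0 < R < 2` (square-free,
`isSquareFreeCoeff_of_lt_two`), a self-sustaining core cannot be a single mode `{i}` — that would need a square
coefficient `α_{ii i,μ} ≠ 0` with `μ₁ = μ₂` or a self-coupling at `(1,0,0)/(0,1,0)`… precisely: every member of a core is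
driven from `C × C`, and for `C = {i}` the driver is `α_{ii i,μ}`; at `μ = (0,0,0), (0,0,1)` it vanishes by
square-freeness and at `μ = (1,0,0), (0,1,0)` by `sqCoeff_eq_zero_of_lt_two` (the back-reaction partners of squares).
[cite: Tao2016AveragedNS, §4 (4.2)–(4.3), §6.1; cell vocabulary (`InTableClass`, self-sustaining core)] -/
theorem two_le_card_core_of_lt_two (hα : InTableClass R α) (hR0 : 0 < R) (hR : R < 2) {C : Finset (Fin m)}
    (hC : C.Nonempty) (hcore : ∀ i ∈ C, ∃ μ ∈ shiftSet, ∃ j ∈ C, ∃ k ∈ C, α j k i μ ≠ 0) : 2 ≤ C.card := by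
  classical
  by_contra hlt
  have hcard : C.card = 1 := by
    have := hC.card_pos
    omega
  obtain ⟨i, hCi⟩ := Finset.card_eq_one.1 hcard
  obtain ⟨μ, hμ, j, hj, k, hk, hne⟩ := hcore i (by rw [hCi]; exact Finset.mem_singleton_self i)
  rw [hCi, Finset.mem_singleton] at hj hk
  rw [hj, hk] at hne
  have hsq := NoSurvivingEternalViscBddOne.SubDyadicSpread.sqCoeff_eq_zero_of_lt_two hα hR0 hR i i
  rw [mem_shiftSet_iff] at hμ
  rcases hμ with rfl | rfl | rfl | rfl
  · exact hne hsq.2.2.2.1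
  · exact hne hsq.2.1
  · exact hne hsq.2.2.1
  · exact hne hsq.1

end BlowupRigidityOne

end Summit.NavierStokesRegularity.NavierStokesRegularity.Theorems

end
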